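import Mathlib
import Summits.ValiantsHypothesis.ValiantsHypothesis.Theses.FifoMatching
import Summits.ValiantsHypothesis.ValiantsHypothesis.Theorems.FifoMatchingNNLinearDegreeCofactorHardShedWordMeasure
import Summits.ValiantsHypothesis.ValiantsHypothesis.Theorems.FifoMatchingNNLinearDegreeCofactorHardOfPricingA
import Summits.ValiantsHypothesis.ValiantsHypothesis.Theorems.FifoMatchingNNLinearDegreeCofactorHardRateGrowthRoot
import HarnessLib

/-!
# Route `FifoMatching`, crux `NNLinearDegreeCofactorHard` (stmt-ValiantsHypothesis-23918): THE CRUX, PROVED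

`NNLinearDegreeCofactorHard_proof : Summit.ValiantsHypothesis.ValiantsHypothesis.Theses.FifoMatching.NNLinearDegreeCofactorHard`
— line `internal_cofactor`: S1 (`stub_topInternalComponent`, p590074) + S2a (`stub_longRunInternalHard`, p590091) + S2b by the
∀c measure μ* = `shedWord` (defects push, R-items are shed at the front, fair bits elsewhere, adaptive drain): band (Azuma) ⇒
balance ⇒ deterministic heart (free-mass / S-boundary dichotomy) ⇒ gate attribution (tests and soft exhaustion gates) ⇒ passage
pricing ⇒ counts (LEAD p2's glue, density constant `a = 1024`) ⇒ the crux.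

* the rate is `0` below the threshold `2M < 2¹⁹²`, else `root16 (2M) / 32` (`rate_hrate`: it grows like a root);
* `hμ_shedWord` — the pricing hypothesis of `InternalCofactor.avoidingCounts_of_pricing 1024` for this rate;
* `NNLinearDegreeCofactorHard_proof` — the crux by name.

HONEST FRAMING: this is a statement about MONOTONE (ℝ≥0) arithmetic circuit complexity of the nest-free matching polynomial with
an internal cofactor; it does NOT prove `NNDivisionHard`, `NNNotVP`, Valiant's hypothesis or VP ≠ VNP (NOT proved); monotone
world only (`Literature.Barriers.ValiantsHypothesis.MonotoneGap`).  No definitions, no named facts. [folklore]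
-/

noncomputable section

-- Sub = Summit single-conjunct layout: the duplicated namespace component is mandated by the tree.
set_option linter.dupNamespace false

namespace Summit.ValiantsHypothesis.ValiantsHypothesis.Theorems.FifoMatching.NNLinearDegreeCofactorHard.ShedWord

open MvPolynomial Finset Literature.Computability.AlgebraicComplexity
open Summit.ValiantsHypothesis.ValiantsHypothesis.Theorems.FifoMatching.NNLowDegreeCofactorHard.FreedVertices.Carve
open Summit.ValiantsHypothesis.ValiantsHypothesis.Theorems.FifoMatching.NNMonotoneHard
open Summit.ValiantsHypothesis.ValiantsHypothesis.Theorems.FifoMatching.NNLinearDegreeCofactorHard.InternalCofactor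
open scoped NNReal

/-- The rate `M ↦ (0 below the threshold, else root16 (2M) / 32)` grows like a root. [folklore] -/
theorem rate_hrate : ∀ M : ℕ, 2 ^ 191 ≤ M →
    M < (64 * ((fun M => if 2 * M < 2 ^ 192 then 0 else root16 (2 * M) / 32) M + 1)) ^ 16 := by
  intro M hM
  simp only
  rw [if_neg (by omega)]
  exact rate_growth (by omega)

/-- **The pricing hypothesis of `avoidingCounts_of_pricing 1024` holds for μ* = shedWord.** [folklore] -/
theorem hμ_shedWord : ∀ n : ℕ, ∀ R : Finset (Fin (2 * n)), 1024 * R.card ≤ 2 * n →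
    ∀ C : Carving n, 3 ≤ C.m → 2 * n ≤ 2 * C.m + 12 * R.card + 4 →
      (∀ t ≤ 2 * C.m,
        4 * ((univ.filter fun j : Fin (2 * C.m) => C.up j ∈ R).filter fun j => j.val < t).card ≤ t ∧
        4 * ((univ.filter fun j : Fin (2 * C.m) => C.up j ∈ R).filter
          fun j => 2 * C.m ≤ j.val + t).card ≤ t) →
      ∃ B : ℕ, ∃ BB : Finset (Fin B → Bool), ∃ f : (Fin B → Bool) → (Fin (2 * C.m) → Fin (2 * C.m)),
        BB.Nonempty ∧
        (∀ y ∈ BB, f y ∈ (nestFreeMatchings (2 * C.m)).filter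
          (fun N => ∀ j ∈ (univ.filter fun j : Fin (2 * C.m) => C.up j ∈ R),
            N j ∉ (univ.filter fun j : Fin (2 * C.m) => C.up j ∈ R))) ∧
        (2 : ℝ) ^ B ≤ 2 * BB.card ∧
        ∀ S : Finset (Fin (2 * C.m)), 2 * C.m < 3 * S.card → 3 * S.card ≤ 4 * C.m →
          ((BB.filter fun y => ∀ i, i ∈ S ↔ f y i ∈ S).card : ℝ) *
            (4 / 3 : ℝ) ^ ((fun M => if 2 * M < 2 ^ 192 then 0 else root16 (2 * M) / 32) C.m) ≤ 2 ^ B := by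
  classical
  intro n R hR C _ hnC hends
  set R' : Finset (Fin (2 * C.m)) := univ.filter fun j : Fin (2 * C.m) => C.up j ∈ R with hR'
  have hN : Even (2 * C.m) := ⟨C.m, two_mul C.m⟩
  have hcard : R'.card ≤ R.card := by
    have h : (R'.map ⟨C.up, C.up_injective⟩) ⊆ R := by
      intro x hx
      rw [mem_map] at hx
      obtain ⟨j, hj, rfl⟩ := hx
      exact (mem_filter.1 hj).2
    have := card_le_card h
    rwa [card_map] at this
  have hRc : 1012 * R'.card ≤ 2 * C.m + 4 := by omega
  have hpre : ∀ t ≤ 2 * C.m, 4 * (R'.filter fun j => j.val < t).card ≤ t := fun t ht => (hends t ht).1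
  have hsuf : ∀ t ≤ 2 * C.m, 4 * (R'.filter fun j => 2 * C.m ≤ j.val + t).card ≤ t := fun t ht => (hends t ht).2
  have h4m : 4 * C.m = 2 * (2 * C.m) := by ring
  by_cases hsmall : 2 * C.m < 2 ^ 192
  · obtain ⟨BB, f, h1, h2, h3, h4⟩ := pricing_small R' hN hsuf
    refine ⟨2 * C.m, BB, f, h1, h2, h3, fun S hS₁ hS₂ => ?_⟩
    simp only; rw [if_pos hsmall]
    exact h4 S hS₁ (by omega)
  · have hg : 4096 ≤ root16 (2 * C.m) := le_root16 (by norm_num; omega)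
    obtain ⟨BB, f, h1, h2, h3, h4⟩ := pricing_large R' hN hg hRc hpre hsuf
    refine ⟨2 * C.m, BB, f, h1, h2, h3, fun S hS₁ hS₂ => ?_⟩
    simp only; rw [if_neg hsmall]
    exact h4 S hS₁ (by omega)

/-- **THE CRUX `NNLinearDegreeCofactorHard` OF ROUTE `FifoMatching` (stmt-ValiantsHypothesis-23918).**  For some `a`
(`a = 1024`), every `c`, and all large `n`: for every nonzero `h` over `ℝ≥0` with `a · deg h ≤ n`, the monotone complexity of
`NF_{2n} · h` plus that of `h` exceeds `2^((log₂ n + c)^c)`.  Monotone world only; VP ≠ VNP is NOT proved. [folklore] -/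
theorem NNLinearDegreeCofactorHard_proof :
    Summit.ValiantsHypothesis.ValiantsHypothesis.Theses.FifoMatching.NNLinearDegreeCofactorHard :=
  nnLinearDegreeCofactorHard_of_avoidingCounts 1024 (by norm_num)
    (avoidingCounts_of_pricing 1024 (by norm_num) (fun M => if 2 * M < 2 ^ 192 then 0 else root16 (2 * M) / 32)
      hμ_shedWord (hr_of_root _ 64 16 (2 ^ 191) (by norm_num) rate_hrate))

end Summit.ValiantsHypothesis.ValiantsHypothesis.Theorems.FifoMatching.NNLinearDegreeCofactorHard.ShedWord

end
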